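import Mathlib
import Literature.Probability.RandomPlanarGeometry.HexSAW
import Summits.CriticalPhenomena.SAWScalingLimit.Theorems.SAWDefectDecoherenceObservableToSLERNestedGateDefs

/-!
# Objects of the line `bridge-gate-renewal`, reshape r4 (ANCHORED families, WIDELY LINKED gate
# pairs), for the crux `ObservableToSLER` (stmt-CriticalPhenomena-14005)

Lead prover `prover-line-stmt-CriticalPhenomena-14005-c1-0` (crux protocol; skeleton
`Summits/CriticalPhenomena/SAWScalingLimit/Cruxes/ObservableToSLER/Lines/bridge_gate_renewal.lean`,
reshape r4 of 2026-08-16).  Companion of `…NestedGateDefs.lean` (p98753, reshape r3: tame nested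
gate families, good gates, wide escapes).  This file only DEFINES the two predicates by which r4
repairs the carved-identification stub of r3, found misstated by its stub worker (audit, 2026-08-16):

* (HOLE) `IsEmbEndpointApprox` admits interior roots `a δ` (at distance `d_δ → 0`, `d_δ/δ → ∞`
  from `∂D`), and `TameNestedFamily` asks only honeycomb-connectivity of each level `S n` as a
  vertex set — so a level may be an interior ISLAND, the carved lattice domain then has an
  unfillable hole with the gate on the hole's boundary, and the flat-class hypothesis `R6` is silent
  there.  Repair: `ExteriorAnchored Ω δ U c` — the level is chained, through its own vertices and
  vertices rescaled outside `Ω`, to infinitely many vertices (the unbounded lattice exterior).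
* (DEAD END) the one-ended `WideEscape` (to distance `2R` from the root) can run DOWN a dead-end
  finger of `D` while every route from the gate `q` to the other gate `q'` passes a lattice-scale
  aperture: the carved law then factorises through a rough root — identification = rough-root
  universality, outside `R6`'s reach.  Repair: the two-ended `WideLink Ω δ ρ U q q'` between the two
  gate windows avoiding the removed set `U = S n ∪ T n'` and `∂Ω` with margin `ρ/4`.  It depends on
  the cell label `(S n, T n', q, q')` only, so the product-cell structure of the assembly is untouched.

No statement of the line is asserted here (only the bookkeeping lemma `stub_wideLink_symm`: a wide
link read backwards is a wide link, used for the reversed-list symmetry of the assembly).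
-/

noncomputable section

open scoped BigOperators Topology NNReal ENNReal Classical
open Filter Set MeasureTheory Metric
open Literature.Probability.LatticeModels (HexVertex hexGraph hexCenter triZeta Site)
open Literature.Probability.RandomPlanarGeometry
open Literature.Probability.RandomPlanarGeometry.SAW

namespace Summit.CriticalPhenomena.SAWScalingLimit.Theorems.ObservableToSLER.NestedGate

/-- `U` is **chained to the unbounded lattice exterior** of `Ω` at mesh `δ` from the root `c`:
infinitely many vertices are reached from `c` by honeycomb walks all of whose vertices lie in `U`
or are rescaled OUTSIDE `Ω`.  (For a preconnected level `U = S n ∋ c` this puts every vertex of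
`U` in the unbounded part of the complement of the carved vertex set: no island, no hole with the
gate on its boundary.) -/
def ExteriorAnchored (Ω : Set ℂ) (δ : ℝ) (U : Set HexVertex) (c : HexVertex) : Prop :=
  {z : HexVertex | ∃ w : hexGraph.Walk c z,
      ∀ y ∈ w.support, y ∈ U ∨ (δ : ℂ) * hexCenter y ∉ Ω}.Infinite

/-- A **`ρ/4`-WIDE LINK** between the two gate windows: a continuous path from within `ρ` of the
rescaled gate vertex `q` to within `ρ` of the rescaled gate vertex `q'`, every point of which has
its closed `ρ/4`-ball inside `Ω` and at distance `≥ ρ/4` from every rescaled vertex of the removed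
set `U` (in the line: `U = S n ∪ T n'`).  Two-ended version of `WideEscape`: no separating pinch
or aperture between `q` and `q'` in the carved domain. -/
def WideLink (Ω : Set ℂ) (δ ρ : ℝ) (U : Set HexVertex) (q q' : HexVertex) : Prop :=
  ∃ (x x' : ℂ) (γ : Path x x'), dist x ((δ : ℂ) * hexCenter q) ≤ ρ ∧
    dist x' ((δ : ℂ) * hexCenter q') ≤ ρ ∧
    ∀ t, closedBall (γ t) (ρ / 4) ⊆ Ω ∧ ∀ v ∈ U, ρ / 4 ≤ dist (γ t) ((δ : ℂ) * hexCenter v)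

/-- Bookkeeping (registered helper `stub_wideLink_symm`): a wide link read backwards is a wide link
(`Path.symm`). Used for the reversed-list symmetry at the far endpoint. -/
theorem stub_wideLink_symm :
    ∀ (Ω : Set ℂ) (δ ρ : ℝ) (U : Set HexVertex) (q q' : HexVertex),
      WideLink Ω δ ρ U q q' → WideLink Ω δ ρ U q' q := by
  intro Ω δ ρ U q q' h
  obtain ⟨x, x', γ, hx, hx', hγ⟩ := h
  refine ⟨x', x, γ.symm, hx', hx, fun t => ?_⟩
  have h := hγ (unitInterval.symm t)
  have e : γ.symm t = γ (unitInterval.symm t) := rfl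
  rw [e]
  exact h

end Summit.CriticalPhenomena.SAWScalingLimit.Theorems.ObservableToSLER.NestedGate

end
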